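import Summits.FinalStateConjecture.FinalStateConjecture.Theorems.PhotonSphereChannelsWindowedShellChannelsNearFarSplit

/-!
# Crux `WindowedShellChannels` (W, item stmt-FinalStateConjecture-14085) — thick shells from a
# FAR-WINDOW-ONLY far half

Support file (registered stub `stub_thickShell_of_farWindow`; `--supports`).  A far-side prover
naturally controls only the one-ended far windows `{x > x_c + a + |t|}` (`farChannelEnergy`); since
`{x > x_c + a + |t|} ⊆ {|x − x_c| > a + |t|}`, `farChannelEnergy V (x_c + a) ψ l ≤ channelEnergy V x_c a ψ l`
(`farChannelEnergy_le_channelEnergy`), and `WindowedShellChannelsSplit.stub_thickShell_of_far` turns a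
far-window-only inequality for far data (lag `h_f ≤ 2ρ`, constant `c_f`) into W for every shell of
half-width `ρ ≥ 9M`.  No definitions are introduced.
-/

noncomputable section

set_option linter.dupNamespace false

open Set Filter Topology Function MeasureTheory
open scoped ENNReal

namespace Summit.FinalStateConjecture.FinalStateConjecture.Theorems.WindowedShellChannelsSplit

open Literature.Geometry.Lorentzian Literature.Geometry.Lorentzian.ReggeWheeler
open Summit.FinalStateConjecture.FinalStateConjecture.Theorems

/-- The one-ended far channel energy beyond the edge `x_c + a` is at most the two-ended channel
energy of aperture `a` about `x_c`. [folklore] -/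
theorem farChannelEnergy_le_channelEnergy (V : ℝ → ℝ) (xc a : ℝ) (ψ : ℝ → ℝ → ℝ) (l : Filter ℝ) :
    farChannelEnergy V (xc + a) ψ l ≤ channelEnergy V xc a ψ l := by
  refine Filter.liminf_le_liminf (Eventually.of_forall fun t => ?_)
  unfold farEnergy exteriorEnergy
  refine lintegral_mono_set fun x hx => ?_
  simp only [mem_setOf_eq] at hx ⊢
  exact lt_of_lt_of_le (by linarith) (le_abs_self (x - xc))

/-- **Registered stub `stub_thickShell_of_farWindow`** (crux `WindowedShellChannels`,
item stmt-FinalStateConjecture-14085): W for every shell of half-width `ρ ≥ 9M` from a far half stated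
with FAR WINDOWS ONLY — for far data (`(x_c + ρ, ∞)`), lag `h_f ≤ 2ρ` and constant `c_f`,
`c_f · E ≤ liminf_{+∞} ∫_{x > x_c + ρ − h_f + |t|} e + liminf_{−∞} ∫_{x > x_c + ρ − h_f + |t|} e` —; aperture
`min (M/3 + 2M log(3/2)) (ρ − h_f)`, constant `min (1/2) c_f`. -/
theorem stub_thickShell_of_farWindow : ∀ M : ℝ, 0 < M → ∀ (ρ hf cf : ℝ), 9 * M ≤ ρ → hf ≤ 2 * ρ → (∀ (r : ℝ → ℝ) (xc : ℝ), IsTortoiseRadius M r xc → ∀ (s ℓ : ℕ), s ≤ 2 → s ≤ ℓ → ∀ ψ : ℝ → ℝ → ℝ, IsRWSolution M s ℓ r ψ → CauchyDataSupportedOn ψ (Set.Ioi (xc + ρ)) → ENNReal.ofReal cf * totalEnergy (linePotential M s ℓ r) ψ 0 ≤ farChannelEnergy (linePotential M s ℓ r) (xc + (ρ - hf)) ψ atTop + farChannelEnergy (linePotential M s ℓ r) (xc + (ρ - hf)) ψ atBot) → ∀ (r : ℝ → ℝ) (xc : ℝ), IsTortoiseRadius M r xc → ∀ (s ℓ : ℕ),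 s ≤ 2 → s ≤ ℓ → ∀ ψ : ℝ → ℝ → ℝ, IsRWSolution M s ℓ r ψ → CauchyDataSupportedOn ψ {x : ℝ | ρ < |x - xc|} → ENNReal.ofReal (min (1 / 2) cf) * totalEnergy (linePotential M s ℓ r) ψ 0 ≤ channelEnergy (linePotential M s ℓ r) xc (min (M / 3 + 2 * M * Real.log (3 / 2)) (ρ - hf)) ψ atTop + channelEnergy (linePotential M s ℓ r) xc (min (M / 3 + 2 * M * Real.log (3 / 2)) (ρ - hf)) ψ atBot := by
  intro M hM ρ hf cf hρ hhf HF
  refine stub_thickShell_of_far M hM ρ hf cf hρ hhf fun r xc hr s ℓ hs hsℓ ψ hψ hsupp => ?_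
  exact (HF r xc hr s ℓ hs hsℓ ψ hψ hsupp).trans (add_le_add
    (farChannelEnergy_le_channelEnergy _ xc (ρ - hf) ψ atTop)
    (farChannelEnergy_le_channelEnergy _ xc (ρ - hf) ψ atBot))

end Summit.FinalStateConjecture.FinalStateConjecture.Theorems.WindowedShellChannelsSplit

end
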